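import Mathlib
import Summits.MatrixMultiplication.MatrixMultiplication.Theorems.BorderHalfDimensionDesigns.Negative.CountingBarrier

/-!
# `GLnSeparatingDesigns.BorderHalfDimensionDesigns` (stmt-MatrixMultiplication-18360) — Negative lane, III:
# a design set inside an affine subspace of `Mat_n(ℂ)` spanned by `m` matrices has at most `(s+1)^m` points
-/

namespace Summit.MatrixMultiplication.MatrixMultiplication.Theorems

open scoped BigOperators Matrix
open Finset

namespace BorderHalfDimensionDesignsNeg

/-! ## (c′) Sub-family kill: no design set can live in a low-dimensional affine subspace

If `X` lies in an affine-linear subspace `A₀ + span(A₁,…,A_m)` of `Mat_n(ℂ)` then the separators of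
the targets `(x₀, z₀)`, restricted to the `|X|` points `x y₀⁻¹ y₀ z₀⁻¹`, are polynomials of degree
`≤ s` in the `m` affine parameters, so `|X| ≤ (s+1)^m`.  With `m ≤ (n² − n)/2` (the unitriangular
group, a Borel unipotent radical, the torus, block vector groups, `exp` of a nilpotent abelian Lie
algebra, and all their two-sided translates `a·S·b`) this contradicts `|X| ≥ q^(n²/2 − εn)` as soon as
`ε < 1/2`: the crux's sets must be ZARISKI-SPREAD in dimension `> n²/2 − εn`, i.e. essentially real
(non-holomorphic) configurations — BCGPU's "real subvariety" remark (2024, Rem. 1.3) made quantitative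
and unconditional.  The same argument bounds `|Y|` (rows `y ↦ p(x₀ y⁻¹ y' z₀⁻¹)`) and `|Z|`. -/

/-- Substituting affine-linear forms does not raise the total degree. [folklore] -/
theorem totalDegree_bind₁_le_of_affine {σ τ : Type*} (ℓ : σ → MvPolynomial τ ℂ)
    (hℓ : ∀ i, (ℓ i).totalDegree ≤ 1) (p : MvPolynomial σ ℂ) :
    (MvPolynomial.bind₁ ℓ p).totalDegree ≤ p.totalDegree := by
  classical
  conv_lhs => rw [p.as_sum]
  rw [map_sum]
  refine MvPolynomial.totalDegree_finsetSum_le fun d hd => ?_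
  rw [MvPolynomial.bind₁_monomial]
  refine (MvPolynomial.totalDegree_mul _ _).trans ?_
  rw [MvPolynomial.totalDegree_C, zero_add]
  refine (MvPolynomial.totalDegree_finsetProd _ _).trans ?_
  refine le_trans (Finset.sum_le_sum fun i _ => (MvPolynomial.totalDegree_pow _ _).trans
    (Nat.mul_le_mul_left _ (hℓ i))) ?_
  simpa [Finsupp.sum] using MvPolynomial.le_totalDegree hd

/-- **Affine sub-family bound.** If `Y, Z ≠ ∅`, every target has an `η`-separator of degree `≤ s`
with `η·|X| < 1`, and `X` lies in an affine subspace of `Mat_n(ℂ)` spanned by `m` matrices, then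
`|X| ≤ (s+1)^m`. [folklore] -/
theorem card_le_of_separators_affine {n m s : ℕ} {X Y Z : Finset (Matrix.GeneralLinearGroup (Fin n) ℂ)} {η : ℝ}
    (hY : Y.Nonempty) (hZ : Z.Nonempty) (hsep : ∀ x₀ ∈ X, ∀ z₀ ∈ Z, ∃ p : MvPolynomial (Fin n × Fin n) ℂ, p.totalDegree ≤ s ∧
      ∀ x ∈ X, ∀ y ∈ Y, ∀ y' ∈ Y, ∀ z ∈ Z,
        ((x = x₀ ∧ y = y' ∧ z = z₀) → ‖MvPolynomial.eval (pt x y y' z) p - 1‖ ≤ η) ∧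
        (¬ (x = x₀ ∧ y = y' ∧ z = z₀) → ‖MvPolynomial.eval (pt x y y' z) p‖ ≤ η))
    (hη : η * X.card < 1)
    (A₀ : Matrix (Fin n) (Fin n) ℂ) (A : Fin m → Matrix (Fin n) (Fin n) ℂ)
    (hX : ∀ x ∈ X, ∃ t : Fin m → ℂ, (x : Matrix (Fin n) (Fin n) ℂ) = A₀ + ∑ k, t k • A k) :
    X.card ≤ (s + 1) ^ m := by
  classical
  obtain ⟨y₀, hy₀⟩ := hY
  obtain ⟨z₀, hz₀⟩ := hZ
  choose p hpdeg hpsep using hsep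
  choose t ht using hX
  set M : Matrix (Fin n) (Fin n) ℂ := ((y₀⁻¹ * y₀ * z₀⁻¹ : Matrix.GeneralLinearGroup (Fin n) ℂ) : Matrix (Fin n) (Fin n) ℂ)
    with hM
  set ℓ : Fin n × Fin n → MvPolynomial (Fin m) ℂ := fun ij =>
    MvPolynomial.C ((A₀ * M) ij.1 ij.2) + ∑ k, MvPolynomial.C ((A k * M) ij.1 ij.2) * MvPolynomial.X k
    with hℓ
  have hℓdeg : ∀ ij, (ℓ ij).totalDegree ≤ 1 := by
    intro ij
    refine (MvPolynomial.totalDegree_add _ _).trans (max_le ?_ ?_)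
    · rw [MvPolynomial.totalDegree_C]; exact Nat.zero_le _
    · refine MvPolynomial.totalDegree_finsetSum_le fun k _ => ?_
      refine (MvPolynomial.totalDegree_mul _ _).trans ?_
      rw [MvPolynomial.totalDegree_C, MvPolynomial.totalDegree_X, zero_add]
  have hPt : ∀ x : ↥X, pt x.1 y₀ y₀ z₀ = fun ij => MvPolynomial.eval (t x.1 x.2) (ℓ ij) := by
    intro x; funext ij
    have hx : ((x.1 * y₀⁻¹ * y₀ * z₀⁻¹ : Matrix.GeneralLinearGroup (Fin n) ℂ) : Matrix (Fin n) (Fin n) ℂ)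
        = (x.1 : Matrix (Fin n) (Fin n) ℂ) * M := by
      simp only [hM, Units.val_mul, mul_assoc]
    simp only [hℓ, map_add, map_sum, map_mul, MvPolynomial.eval_C, MvPolynomial.eval_X]
    rw [hx, ht x.1 x.2, Matrix.add_mul, Finset.sum_mul, Matrix.add_apply]
    congr 1
    rw [Matrix.sum_apply]
    refine Finset.sum_congr rfl fun k _ => ?_
    rw [Matrix.smul_mul, Matrix.smul_apply, smul_eq_mul, mul_comm]
  set f : ↥X → ↥X → ℂ := fun i j => MvPolynomial.eval (pt j.1 y₀ y₀ z₀) (p i.1 i.2 z₀ hz₀) with hf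
  set mono : (Fin m → Fin (s + 1)) → (↥X → ℂ) := fun μ j => ∏ k, (t j.1 j.2 k) ^ (μ k : ℕ)
    with hmono
  set W : Submodule ℂ (↥X → ℂ) := Submodule.span ℂ (Set.range mono) with hW
  have hWle : Module.finrank ℂ W ≤ (s + 1) ^ m := by
    have h := finrank_range_le_card (R := ℂ) mono
    simpa [W, Set.finrank, Fintype.card_fun, Fintype.card_fin] using h
  have hfW : ∀ i, f i ∈ W := by
    intro i
    set Q := MvPolynomial.bind₁ ℓ (p i.1 i.2 z₀ hz₀) with hQ
    have hQdeg : Q.totalDegree ≤ s :=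
      (totalDegree_bind₁_le_of_affine ℓ hℓdeg _).trans (hpdeg _ _ _ _)
    have hexp : f i = ∑ d ∈ Q.support, (MvPolynomial.coeff d Q) • (fun j => ∏ k, t j.1 j.2 k ^ d k) := by
      funext j
      simp only [f, Finset.sum_apply, Pi.smul_apply, smul_eq_mul]
      rw [hPt j, show MvPolynomial.eval (fun ij => MvPolynomial.eval (t j.1 j.2) (ℓ ij)) (p i.1 i.2 z₀ hz₀)
          = MvPolynomial.eval (t j.1 j.2) Q from (MvPolynomial.eval₂Hom_bind₁ _ _ _ _).symm,
        MvPolynomial.eval_eq]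
      refine Finset.sum_congr rfl fun d _ => ?_
      congr 1
      exact Finset.prod_subset (Finset.subset_univ _)
        (fun k _ hk => by rw [Finsupp.notMem_support_iff.mp hk, pow_zero])
    rw [hexp]
    refine Submodule.sum_mem _ fun d hd => Submodule.smul_mem _ _ (Submodule.subset_span ?_)
    refine ⟨fun k => ⟨d k, Nat.lt_succ_of_le ((apply_le_totalDegree hd k).trans hQdeg)⟩, ?_⟩
    funext j
    simp [mono]
  have hcard : Fintype.card ↥X = X.card := by simp
  have key := card_le_finrank_of_approx_dual W f hfW η (by rw [hcard]; exact hη)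
    (fun i => (hpsep i.1 i.2 z₀ hz₀ i.1 i.2 y₀ hy₀ y₀ hy₀ z₀ hz₀).1 ⟨rfl, rfl, rfl⟩)
    (fun i j hij => (hpsep i.1 i.2 z₀ hz₀ j.1 j.2 y₀ hy₀ y₀ hy₀ z₀ hz₀).2
      (fun h => hij (Subtype.ext h.1).symm))
  rw [hcard] at key
  exact key.trans hWle

/-- **Affine sub-family bound for `Y`.** If `X, Z ≠ ∅`, some target has an `η`-separator of degree
`≤ s` with `η·|Y| < 1`, and `Y` lies in an affine subspace of `Mat_n(ℂ)` spanned by `m` matrices, then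
`|Y| ≤ (s+1)^m`: the `|Y| × |Y|` matrix `p(x₀ y⁻¹ y' z₀⁻¹) ≈ 1` has rows polynomial of degree `≤ s` in
the `m` affine parameters of `y'`.  (So `Y` central / diagonal / abelian-unipotent is impossible for
the crux.) [folklore] -/
theorem card_Y_le_of_separators_affine {n m s : ℕ} {X Y Z : Finset (Matrix.GeneralLinearGroup (Fin n) ℂ)} {η : ℝ}
    (hXne : X.Nonempty) (hZne : Z.Nonempty) (hsep : ∀ x₀ ∈ X, ∀ z₀ ∈ Z, ∃ p : MvPolynomial (Fin n × Fin n) ℂ, p.totalDegree ≤ s ∧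
      ∀ x ∈ X, ∀ y ∈ Y, ∀ y' ∈ Y, ∀ z ∈ Z,
        ((x = x₀ ∧ y = y' ∧ z = z₀) → ‖MvPolynomial.eval (pt x y y' z) p - 1‖ ≤ η) ∧
        (¬ (x = x₀ ∧ y = y' ∧ z = z₀) → ‖MvPolynomial.eval (pt x y y' z) p‖ ≤ η))
    (hη : η * Y.card < 1)
    (A₀ : Matrix (Fin n) (Fin n) ℂ) (A : Fin m → Matrix (Fin n) (Fin n) ℂ)
    (hY : ∀ y ∈ Y, ∃ t : Fin m → ℂ, (y : Matrix (Fin n) (Fin n) ℂ) = A₀ + ∑ k, t k • A k) :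
    Y.card ≤ (s + 1) ^ m := by
  classical
  obtain ⟨x₀, hx₀⟩ := hXne
  obtain ⟨z₀, hz₀⟩ := hZne
  obtain ⟨p, hpdeg, hpsep⟩ := hsep x₀ hx₀ z₀ hz₀
  choose t ht using hY
  set R : Matrix (Fin n) (Fin n) ℂ := ((z₀⁻¹ : Matrix.GeneralLinearGroup (Fin n) ℂ) : Matrix (Fin n) (Fin n) ℂ) with hR
  set L : ↥Y → Matrix (Fin n) (Fin n) ℂ := fun y => ((x₀ * y.1⁻¹ : Matrix.GeneralLinearGroup (Fin n) ℂ) : Matrix (Fin n) (Fin n) ℂ)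
    with hL
  set ℓ : ↥Y → Fin n × Fin n → MvPolynomial (Fin m) ℂ := fun y ij =>
    MvPolynomial.C ((L y * A₀ * R) ij.1 ij.2) + ∑ k, MvPolynomial.C ((L y * A k * R) ij.1 ij.2) * MvPolynomial.X k
    with hℓ
  have hℓdeg : ∀ y ij, (ℓ y ij).totalDegree ≤ 1 := by
    intro y ij
    refine (MvPolynomial.totalDegree_add _ _).trans (max_le ?_ ?_)
    · rw [MvPolynomial.totalDegree_C]; exact Nat.zero_le _
    · refine MvPolynomial.totalDegree_finsetSum_le fun k _ => ?_
      refine (MvPolynomial.totalDegree_mul _ _).trans ?_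
      rw [MvPolynomial.totalDegree_C, MvPolynomial.totalDegree_X, zero_add]
  have hPt : ∀ y y' : ↥Y, pt x₀ y.1 y'.1 z₀ = fun ij => MvPolynomial.eval (t y'.1 y'.2) (ℓ y ij) := by
    intro y y'; funext ij
    have hx : ((x₀ * y.1⁻¹ * y'.1 * z₀⁻¹ : Matrix.GeneralLinearGroup (Fin n) ℂ) : Matrix (Fin n) (Fin n) ℂ)
        = L y * (y'.1 : Matrix (Fin n) (Fin n) ℂ) * R := by
      simp only [hL, hR, Units.val_mul]
    simp only [hℓ, map_add, map_sum, map_mul, MvPolynomial.eval_C, MvPolynomial.eval_X]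
    rw [hx, ht y'.1 y'.2, Matrix.mul_add, Matrix.add_mul, Matrix.mul_sum, Finset.sum_mul,
      Matrix.add_apply]
    congr 1
    rw [Matrix.sum_apply]
    refine Finset.sum_congr rfl fun k _ => ?_
    rw [Matrix.mul_smul, Matrix.smul_mul, Matrix.smul_apply, smul_eq_mul, mul_comm]
  set f : ↥Y → ↥Y → ℂ := fun y y' => MvPolynomial.eval (pt x₀ y.1 y'.1 z₀) p with hf
  set mono : (Fin m → Fin (s + 1)) → (↥Y → ℂ) := fun μ j => ∏ k, (t j.1 j.2 k) ^ (μ k : ℕ)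
    with hmono
  set W : Submodule ℂ (↥Y → ℂ) := Submodule.span ℂ (Set.range mono) with hW
  have hWle : Module.finrank ℂ W ≤ (s + 1) ^ m := by
    have h := finrank_range_le_card (R := ℂ) mono
    simpa [W, Set.finrank, Fintype.card_fun, Fintype.card_fin] using h
  have hfW : ∀ i, f i ∈ W := by
    intro i
    set Q := MvPolynomial.bind₁ (ℓ i) p with hQ
    have hQdeg : Q.totalDegree ≤ s := (totalDegree_bind₁_le_of_affine (ℓ i) (hℓdeg i) _).trans hpdeg
    have hexp : f i = ∑ d ∈ Q.support, (MvPolynomial.coeff d Q) • (fun j => ∏ k, t j.1 j.2 k ^ d k) := by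
      funext j
      simp only [f, Finset.sum_apply, Pi.smul_apply, smul_eq_mul]
      rw [hPt i j, show MvPolynomial.eval (fun ij => MvPolynomial.eval (t j.1 j.2) (ℓ i ij)) p
          = MvPolynomial.eval (t j.1 j.2) Q from (MvPolynomial.eval₂Hom_bind₁ _ _ _ _).symm,
        MvPolynomial.eval_eq]
      refine Finset.sum_congr rfl fun d _ => ?_
      congr 1
      exact Finset.prod_subset (Finset.subset_univ _)
        (fun k _ hk => by rw [Finsupp.notMem_support_iff.mp hk, pow_zero])
    rw [hexp]
    refine Submodule.sum_mem _ fun d hd => Submodule.smul_mem _ _ (Submodule.subset_span ?_)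
    refine ⟨fun k => ⟨d k, Nat.lt_succ_of_le ((apply_le_totalDegree hd k).trans hQdeg)⟩, ?_⟩
    funext j
    simp [mono]
  have hcard : Fintype.card ↥Y = Y.card := by simp
  have key := card_le_finrank_of_approx_dual W f hfW η (by rw [hcard]; exact hη)
    (fun i => (hpsep x₀ hx₀ i.1 i.2 i.1 i.2 z₀ hz₀).1 ⟨rfl, rfl, rfl⟩)
    (fun i j hij => (hpsep x₀ hx₀ i.1 i.2 j.1 j.2 z₀ hz₀).2 (fun h => hij (Subtype.ext h.2.1)))
  rw [hcard] at key
  exact key.trans hWle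

/-- **Affine sub-family bound for `Z` (through `Z⁻¹`).** If `X, Y ≠ ∅`, every target has an
`η`-separator of degree `≤ s` with `η·|Z| < 1`, and the INVERSES of the elements of `Z` lie in an affine
subspace of `Mat_n(ℂ)` spanned by `m` matrices (e.g. `Z` inside a translate of an algebraic subgroup
contained in an affine subspace: unitriangular, torus, vector group), then `|Z| ≤ (s+1)^m`.  (`Z` enters
the sampled point `x y⁻¹ y' z⁻¹` only through `z⁻¹`, and `g ↦ g⁻¹` does not preserve polynomiality, so
the hypothesis is on `Z⁻¹`.) [folklore] -/
theorem card_Z_le_of_separators_affineInv {n m s : ℕ} {X Y Z : Finset (Matrix.GeneralLinearGroup (Fin n) ℂ)} {η : ℝ}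
    (hXne : X.Nonempty) (hY : Y.Nonempty) (hsep : ∀ x₀ ∈ X, ∀ z₀ ∈ Z, ∃ p : MvPolynomial (Fin n × Fin n) ℂ, p.totalDegree ≤ s ∧
      ∀ x ∈ X, ∀ y ∈ Y, ∀ y' ∈ Y, ∀ z ∈ Z,
        ((x = x₀ ∧ y = y' ∧ z = z₀) → ‖MvPolynomial.eval (pt x y y' z) p - 1‖ ≤ η) ∧
        (¬ (x = x₀ ∧ y = y' ∧ z = z₀) → ‖MvPolynomial.eval (pt x y y' z) p‖ ≤ η))
    (hη : η * Z.card < 1)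
    (A₀ : Matrix (Fin n) (Fin n) ℂ) (A : Fin m → Matrix (Fin n) (Fin n) ℂ)
    (hZ : ∀ z ∈ Z, ∃ t : Fin m → ℂ, ((z⁻¹ : Matrix.GeneralLinearGroup (Fin n) ℂ) : Matrix (Fin n) (Fin n) ℂ) = A₀ + ∑ k, t k • A k) :
    Z.card ≤ (s + 1) ^ m := by
  classical
  obtain ⟨x₀, hx₀⟩ := hXne
  obtain ⟨y₀, hy₀⟩ := hY
  choose p hpdeg hpsep using hsep
  choose t ht using hZ
  set L : Matrix (Fin n) (Fin n) ℂ := ((x₀ * y₀⁻¹ * y₀ : Matrix.GeneralLinearGroup (Fin n) ℂ) : Matrix (Fin n) (Fin n) ℂ) with hL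
  set ℓ : Fin n × Fin n → MvPolynomial (Fin m) ℂ := fun ij =>
    MvPolynomial.C ((L * A₀) ij.1 ij.2) + ∑ k, MvPolynomial.C ((L * A k) ij.1 ij.2) * MvPolynomial.X k
    with hℓ
  have hℓdeg : ∀ ij, (ℓ ij).totalDegree ≤ 1 := by
    intro ij
    refine (MvPolynomial.totalDegree_add _ _).trans (max_le ?_ ?_)
    · rw [MvPolynomial.totalDegree_C]; exact Nat.zero_le _
    · refine MvPolynomial.totalDegree_finsetSum_le fun k _ => ?_
      refine (MvPolynomial.totalDegree_mul _ _).trans ?_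
      rw [MvPolynomial.totalDegree_C, MvPolynomial.totalDegree_X, zero_add]
  have hPt : ∀ z : ↥Z, pt x₀ y₀ y₀ z.1 = fun ij => MvPolynomial.eval (t z.1 z.2) (ℓ ij) := by
    intro z; funext ij
    have hx : ((x₀ * y₀⁻¹ * y₀ * z.1⁻¹ : Matrix.GeneralLinearGroup (Fin n) ℂ) : Matrix (Fin n) (Fin n) ℂ)
        = L * ((z.1⁻¹ : Matrix.GeneralLinearGroup (Fin n) ℂ) : Matrix (Fin n) (Fin n) ℂ) := by
      simp only [hL, Units.val_mul]
    simp only [hℓ, map_add, map_sum, map_mul, MvPolynomial.eval_C, MvPolynomial.eval_X]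
    rw [hx, ht z.1 z.2, Matrix.mul_add, Matrix.mul_sum, Matrix.add_apply]
    congr 1
    rw [Matrix.sum_apply]
    refine Finset.sum_congr rfl fun k _ => ?_
    rw [Matrix.mul_smul, Matrix.smul_apply, smul_eq_mul, mul_comm]
  set f : ↥Z → ↥Z → ℂ := fun i j => MvPolynomial.eval (pt x₀ y₀ y₀ j.1) (p x₀ hx₀ i.1 i.2) with hf
  set mono : (Fin m → Fin (s + 1)) → (↥Z → ℂ) := fun μ j => ∏ k, (t j.1 j.2 k) ^ (μ k : ℕ)
    with hmono
  set W : Submodule ℂ (↥Z → ℂ) := Submodule.span ℂ (Set.range mono) with hW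
  have hWle : Module.finrank ℂ W ≤ (s + 1) ^ m := by
    have h := finrank_range_le_card (R := ℂ) mono
    simpa [W, Set.finrank, Fintype.card_fun, Fintype.card_fin] using h
  have hfW : ∀ i, f i ∈ W := by
    intro i
    set Q := MvPolynomial.bind₁ ℓ (p x₀ hx₀ i.1 i.2) with hQ
    have hQdeg : Q.totalDegree ≤ s :=
      (totalDegree_bind₁_le_of_affine ℓ hℓdeg _).trans (hpdeg _ _ _ _)
    have hexp : f i = ∑ d ∈ Q.support, (MvPolynomial.coeff d Q) • (fun j => ∏ k, t j.1 j.2 k ^ d k) := by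
      funext j
      simp only [f, Finset.sum_apply, Pi.smul_apply, smul_eq_mul]
      rw [hPt j, show MvPolynomial.eval (fun ij => MvPolynomial.eval (t j.1 j.2) (ℓ ij)) (p x₀ hx₀ i.1 i.2)
          = MvPolynomial.eval (t j.1 j.2) Q from (MvPolynomial.eval₂Hom_bind₁ _ _ _ _).symm,
        MvPolynomial.eval_eq]
      refine Finset.sum_congr rfl fun d _ => ?_
      congr 1
      exact Finset.prod_subset (Finset.subset_univ _)
        (fun k _ hk => by rw [Finsupp.notMem_support_iff.mp hk, pow_zero])
    rw [hexp]
    refine Submodule.sum_mem _ fun d hd => Submodule.smul_mem _ _ (Submodule.subset_span ?_)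
    refine ⟨fun k => ⟨d k, Nat.lt_succ_of_le ((apply_le_totalDegree hd k).trans hQdeg)⟩, ?_⟩
    funext j
    simp [mono]
  have hcard : Fintype.card ↥Z = Z.card := by simp
  have key := card_le_finrank_of_approx_dual W f hfW η (by rw [hcard]; exact hη)
    (fun i => (hpsep x₀ hx₀ i.1 i.2 x₀ hx₀ y₀ hy₀ y₀ hy₀ i.1 i.2).1 ⟨rfl, rfl, rfl⟩)
    (fun i j hij => (hpsep x₀ hx₀ i.1 i.2 x₀ hx₀ y₀ hy₀ y₀ hy₀ j.1 j.2).2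
      (fun h => hij (Subtype.ext h.2.2).symm))
  rw [hcard] at key
  exact key.trans hWle

end BorderHalfDimensionDesignsNeg

end Summit.MatrixMultiplication.MatrixMultiplication.Theorems
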